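import Summits.Ventures.Crystal3D.Theorems.StickyWulffConstantGenericWallFloorStackLedgerOneSidedDownWide
import Summits.Ventures.Crystal3D.Theorems.StickyWulffConstantGenericWallFloorStackLedgerLocalWordWide
import HarnessLib

/-!
# Grain 2's one-sided floors with the WIDE tilt: down-slots of `e₃`-component `≤ −9/20`, word and orientation corollaries
# (crux `GenericWallFloor`, stmt-Ventures-19480, line `WallLedgerG`)

HONEST FRAMING. Venture `Summits/Ventures/Crystal3D` (cell `crystal3d-full`), helper `--supports` the crux `GenericWallFloor`,
REGISTERED line `WallLedgerG`, open stub `stub_twoSlabAdhesion`.  Rung credit only; F-C1 not moved; NOT the crux (charges `< 1`;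
inputs `ExactOnly`(C12-55), `StarPairFar` BY NAME).  Mirror of `…AtHalfWide` on `twoSlabAdhesion_stackLedger_oneSidedDown_wide`:
`genericWallFloorAtCharge_oneSidedDown_wide_of_far`, `genericWallFloorAtCharge_wordDown_wide_of_inner_le` (in-plane down-slot
with `⟪A₂u₂,e₃⟫ ≤ −9/20`), `genericWallFloorAtCharge_wordDown_wide_of_tilted_plane` (end mirror plane `ν = A₂μ` with
`(√3/2)√(1−⟪ν,e₃⟫²) ≥ 9/20` ⇒ charge `(√6/4)√(1−⟪ν,e₃⟫²)`).  NOT `c₀ = 1`; F-C1 not moved.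
-/

noncomputable section

namespace Summit.Ventures.Crystal3D.Theorems

open Summit.Ventures.Crystal3D Finset
open Literature.MathematicalPhysics.StatisticalMechanics (fccStacking barlowStacking IsHaggSeq)
open scoped InnerProductSpace

open scoped Classical in
/-- **Charge `½κ₂` from grain 2 alone, wide tilt** (`‖z + e₃‖ ≤ 1/3`), modulo `ExactOnly`(C12-55) and `StarPairFar`. -/
theorem genericWallFloorAtCharge_oneSidedDown_wide_of_far
    {s₀ : EuclideanSpace ℝ (Fin 3)} (hs₀ : s₀ ∈ fccSlots)
    (hcert : ExactOnly 0 (fccSlots.filter fun w => 0 < ⟪w, s₀⟫_ℝ)) (hfar : StarPairFar)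
    (A₁ : EuclideanSpace ℝ (Fin 3) ≃ₗᵢ[ℝ] EuclideanSpace ℝ (Fin 3)) (t₁ : EuclideanSpace ℝ (Fin 3))
    (A₂ : EuclideanSpace ℝ (Fin 3) ≃ₗᵢ[ℝ] EuclideanSpace ℝ (Fin 3)) (t₂ : EuclideanSpace ℝ (Fin 3))
    {z : EuclideanSpace ℝ (Fin 3)} (hz : ‖z‖ = 1) (hze : ‖z + EuclideanSpace.single (2 : Fin 3) (1 : ℝ)‖ ≤ 1 / 3)
    {u₂ : EuclideanSpace ℝ (Fin 3)} (hu₂ : u₂ ∈ fccSlots) (hsteep₂ : Real.sqrt 2 / 2 ≤ ⟪A₂ u₂, z⟫_ℝ)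
    (M₂ : Set (EuclideanSpace ℝ (Fin 3) ≃ₗᵢ[ℝ] EuclideanSpace ℝ (Fin 3)))
    (hM₂ : ∀ stk : List WalkEntry, StackSound z stk → StackWF z stk → stk.getLast? = some ⟨A₂, u₂, 0⟩ →
      ∀ e ∈ stk, e.frame ∈ M₂)
    (hmiss : ∀ F ∈ M₂, F '' fccStacking 1 (Real.sqrt (2 / 3)) ≠ A₁ '' fccStacking 1 (Real.sqrt (2 / 3))) :
    GenericWallFloorAtCharge (Real.sqrt 2 * |⟪A₂ u₂, EuclideanSpace.single (2 : Fin 3) (1 : ℝ)⟫_ℝ| / 2) A₁ t₁ A₂ t₂ :=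
  genericWallFloorAtCharge_of_ledger _ A₁ t₁ A₂ t₂
    (twoSlabAdhesion_stackLedger_oneSidedDown_wide hs₀ hcert (doubleStarCoaxialAt_of_starPairFar hfar)
      (capPairCoaxial_of_starPairFar hfar) A₁ t₁ A₂ t₂ hz hze hu₂ hsteep₂ M₂ hM₂ hmiss)

open scoped Classical in
/-- **Word floor from grain 2, wide tilt**: chain pair `A₁·Λ₀ = (wordFrame A₂ κ)·Λ₀`, `|κ| ≥ 2`, down-slot `u₂` IN grain 2's
first mirror plane with `⟪A₂u₂, e₃⟫ ≤ −9/20`: `GenericWallFloorAtCharge ((√2/2)|⟪A₂u₂, e₃⟫|)`. -/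
theorem genericWallFloorAtCharge_wordDown_wide_of_inner_le
    {s₀ : EuclideanSpace ℝ (Fin 3)} (hs₀ : s₀ ∈ fccSlots)
    (hcert : ExactOnly 0 (fccSlots.filter fun w => 0 < ⟪w, s₀⟫_ℝ)) (hfar : StarPairFar)
    (A₁ : EuclideanSpace ℝ (Fin 3) ≃ₗᵢ[ℝ] EuclideanSpace ℝ (Fin 3)) (t₁ : EuclideanSpace ℝ (Fin 3))
    (A₂ : EuclideanSpace ℝ (Fin 3) ≃ₗᵢ[ℝ] EuclideanSpace ℝ (Fin 3)) (t₂ : EuclideanSpace ℝ (Fin 3))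
    {u₂ : EuclideanSpace ℝ (Fin 3)} (hu₂ : u₂ ∈ fccSlots)
    (hdown : ⟪A₂ u₂, EuclideanSpace.single (2 : Fin 3) (1 : ℝ)⟫_ℝ ≤ -(9 / 20 : ℝ))
    (κ : List (EuclideanSpace ℝ (Fin 3)))
    (hκl : ∀ μ ∈ κ, ‖μ‖ = 1 ∧
      ∀ w ∈ fccSlots, ⟪w, μ⟫_ℝ = 0 ∨ ⟪w, μ⟫_ℝ = Real.sqrt (2 / 3) ∨ ⟪w, μ⟫_ℝ = -Real.sqrt (2 / 3))
    (hκc : List.IsChain (fun μ μ' => ⟪μ, μ'⟫_ℝ = 1 / 3 ∨ ⟪μ, μ'⟫_ℝ = -1 / 3) κ) (hκ2 : 2 ≤ κ.length)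
    (hA₁ : A₁ '' fccStacking 1 (Real.sqrt (2 / 3)) = (wordFrame A₂ κ) '' fccStacking 1 (Real.sqrt (2 / 3)))
    (hfirst : ∀ μ, κ.getLast? = some μ → ⟪u₂, μ⟫_ℝ = 0) :
    GenericWallFloorAtCharge (Real.sqrt 2 * |⟪A₂ u₂, EuclideanSpace.single (2 : Fin 3) (1 : ℝ)⟫_ℝ| / 2) A₁ t₁ A₂ t₂ := by
  obtain ⟨z, hz, hze, hsteep⟩ := exists_tilt_vertical_down_wide
    (by rw [LinearIsometryEquiv.norm_map, norm_eq_one_of_mem_fccSlots hu₂]) hdown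
  exact genericWallFloorAtCharge_oneSidedDown_wide_of_far hs₀ hcert hfar A₁ t₁ A₂ t₂ hz hze hu₂ hsteep
    {F | ∃ stk : List WalkEntry, StackSound z stk ∧ StackWF z stk ∧ stk.getLast? = some ⟨A₂, u₂, 0⟩ ∧
      ∃ e ∈ stk, e.frame = F}
    (fun stk hS hW hlast e he => ⟨stk, hS, hW, hlast, e, he, rfl⟩)
    (fun _ ⟨_, hS, hW, hl, _, he, hF⟩ => by rw [← hF]; exact image_ne_of_word κ hκl hκc hκ2 hA₁ hfirst hS hW hl he)

open scoped Classical in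
/-- **Word floor from grain 2 as an orientation condition, wide tilt**: `ν = A₂ μ` (grain 2's first mirror plane normal) with
`(√3/2)·√(1 − ⟪ν,e₃⟫²) ≥ 9/20` ⇒ `GenericWallFloorAtCharge ((√6/4)·√(1 − ⟪ν,e₃⟫²))`. -/
theorem genericWallFloorAtCharge_wordDown_wide_of_tilted_plane
    {s₀ : EuclideanSpace ℝ (Fin 3)} (hs₀ : s₀ ∈ fccSlots)
    (hcert : ExactOnly 0 (fccSlots.filter fun w => 0 < ⟪w, s₀⟫_ℝ)) (hfar : StarPairFar)
    (A₁ : EuclideanSpace ℝ (Fin 3) ≃ₗᵢ[ℝ] EuclideanSpace ℝ (Fin 3)) (t₁ : EuclideanSpace ℝ (Fin 3))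
    (A₂ : EuclideanSpace ℝ (Fin 3) ≃ₗᵢ[ℝ] EuclideanSpace ℝ (Fin 3)) (t₂ : EuclideanSpace ℝ (Fin 3))
    (κ : List (EuclideanSpace ℝ (Fin 3)))
    (hκl : ∀ μ ∈ κ, ‖μ‖ = 1 ∧
      ∀ w ∈ fccSlots, ⟪w, μ⟫_ℝ = 0 ∨ ⟪w, μ⟫_ℝ = Real.sqrt (2 / 3) ∨ ⟪w, μ⟫_ℝ = -Real.sqrt (2 / 3))
    (hκc : List.IsChain (fun μ μ' => ⟪μ, μ'⟫_ℝ = 1 / 3 ∨ ⟪μ, μ'⟫_ℝ = -1 / 3) κ) (hκ2 : 2 ≤ κ.length)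
    (hA₁ : A₁ '' fccStacking 1 (Real.sqrt (2 / 3)) = (wordFrame A₂ κ) '' fccStacking 1 (Real.sqrt (2 / 3)))
    {μ : EuclideanSpace ℝ (Fin 3)} (hμ : κ.getLast? = some μ)
    (htilt : (9 / 20 : ℝ) ≤ Real.sqrt 3 / 2 * Real.sqrt (1 - ⟪A₂ μ, EuclideanSpace.single (2 : Fin 3) (1 : ℝ)⟫_ℝ ^ 2)) :
    GenericWallFloorAtCharge (Real.sqrt 6 / 4 * Real.sqrt (1 - ⟪A₂ μ, EuclideanSpace.single (2 : Fin 3) (1 : ℝ)⟫_ℝ ^ 2)) A₁ t₁ A₂ t₂ := by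
  set e : EuclideanSpace ℝ (Fin 3) := EuclideanSpace.single (2 : Fin 3) (1 : ℝ) with he
  have hμκ := hκl μ (List.mem_of_getLast? hμ)
  have hlt : ⟪A₂ μ, e⟫_ℝ ^ 2 < 1 := by
    by_contra hge
    push Not at hge
    have : Real.sqrt (1 - ⟪A₂ μ, e⟫_ℝ ^ 2) = 0 := Real.sqrt_eq_zero'.2 (by linarith)
    rw [this, mul_zero] at htilt
    norm_num at htilt
  obtain ⟨w, hw, hwν, hwe⟩ := exists_inPlane_slot_ge_sin A₂ (ν := A₂ μ) (by rw [LinearIsometryEquiv.norm_map, hμκ.1])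
    (fun w hw => by rw [LinearIsometryEquiv.inner_map_map]; exact hμκ.2 w hw) hlt
  have hw' : -w ∈ fccSlots := neg_mem_fccSlots hw
  have hdown : ⟪A₂ (-w), e⟫_ℝ ≤ -(9 / 20 : ℝ) := by
    rw [map_neg, inner_neg_left]; linarith [htilt.trans hwe]
  have hplane : ⟪-w, μ⟫_ℝ = 0 := by
    rw [inner_neg_left, ← LinearIsometryEquiv.inner_map_map A₂, hwν, neg_zero]
  have h := genericWallFloorAtCharge_wordDown_wide_of_inner_le hs₀ hcert hfar A₁ t₁ A₂ t₂ hw' hdown κ hκl hκc hκ2 hA₁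
    (fun μ' hμ' => by rw [hμ] at hμ'; obtain rfl := Option.some.inj hμ'; exact hplane)
  refine genericWallFloorAtCharge_mono ?_ h
  have habs : |⟪A₂ (-w), e⟫_ℝ| = ⟪A₂ w, e⟫_ℝ := by
    rw [map_neg, inner_neg_left, abs_neg, abs_of_nonneg (by linarith [htilt.trans hwe])]
  rw [habs]
  exact sqrt6_div_four_mul_le hwe

end Summit.Ventures.Crystal3D.Theorems

end
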